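import Summits.QuantumFields.YangMills.Theorems.EquipartitionCriticalityEquipartitionPinsProbeKernelClosed
import Literature.MathematicalPhysics.QuantumFieldTheory.CurvatureGaussianField
import HarnessLib

/-!
# Stub `stub_curlClosed` of line `Sketch` (crux `stmt-QuantumFields-8760`)

Route `EquipartitionCriticality` of `YangMills`, crux item `stmt-QuantumFields-8760`
(`Summit.QuantumFields.YangMills.Theses.EquipartitionCriticality.EquipartitionPinsProbe`), line
`Sketch`, stub `stub_curlClosed`.

What is proved: the lattice identity `d ∘ d = 0` from `1`-cochains to `3`-cochains of `ℤ⁴`: for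
every `1`-cochain `A : ZdEdge 4 → ℝ` and every `3`-cell `(x; i < j < k)`, the cube coboundary
`∂ᵢ (dA)_{jk} − ∂ⱼ (dA)_{ik} + ∂ₖ (dA)_{ij}` of the curl `dA = plaquetteCurl A` vanishes at `x`
(`∂ᵢ` the forward difference along `eᵢ`).

Proof: this is the dimension-`4` instance of the tree lemma
`KernelClosed.cube_coboundary_plaquetteCurl` (file `…EquipartitionPinsProbeKernelClosed`, valid
for every `1`-cochain in every dimension): expanding the six curls with `plaquetteCurl_eq` and
aligning `x + eᵢ + eⱼ = x + eⱼ + eᵢ`, the twenty-four edge terms cancel in pairs. A self-contained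
three-line proof (`simp only [plaquetteCurl_eq, add_right_comm …]; ring`) is recorded as
`TangentCurlClosed.cube_coboundary_plaquetteCurl_four` for readers of this file.
-/

noncomputable section

open Literature.MathematicalPhysics.QuantumFieldTheory Literature.MathematicalPhysics.QuantumLattice
  Literature.Probability.LatticeModels

namespace Summit.QuantumFields.YangMills.Theorems.EquipartitionPinsProbe

namespace TangentCurlClosed

/-- **`d ∘ d = 0` on `ℤ⁴`, self-contained form.** For every `1`-cochain `A` and every `3`-cell
`(x; i < j < k)` of `ℤ⁴`, `∂ᵢ (dA)_{jk} − ∂ⱼ (dA)_{ik} + ∂ₖ (dA)_{ij} = 0` at `x`, where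
`dA = plaquetteCurl A`; direct proof by expanding `plaquetteCurl_eq` and normalising base points. -/
theorem cube_coboundary_plaquetteCurl_four (A : ZdEdge 4 → ℝ) (x : Site 4) (i j k : Fin 4)
    (hij : i < j) (hjk : j < k) :
    (plaquetteCurl A (x + Pi.single i 1, ⟨(j, k), hjk⟩) - plaquetteCurl A (x, ⟨(j, k), hjk⟩)) -
        (plaquetteCurl A (x + Pi.single j 1, ⟨(i, k), hij.trans hjk⟩) -
          plaquetteCurl A (x, ⟨(i, k), hij.trans hjk⟩)) +
        (plaquetteCurl A (x + Pi.single k 1, ⟨(i, j), hij⟩) - plaquetteCurl A (x, ⟨(i, j), hij⟩)) =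
      0 := by
  simp only [plaquetteCurl_eq, add_right_comm x (Pi.single j 1) (Pi.single i 1),
    add_right_comm x (Pi.single k 1) (Pi.single i 1), add_right_comm x (Pi.single k 1) (Pi.single j 1)]
  ring

end TangentCurlClosed

/-- STUB `stub_curlClosed` — **the curl of a `1`-cochain is closed** (`d ∘ d = 0` on `ℤ⁴`): for
every `A : ZdEdge 4 → ℝ` and every `3`-cell `(x; i < j < k)`,
`∂ᵢ (dA)_{jk} − ∂ⱼ (dA)_{ik} + ∂ₖ (dA)_{ij} = 0` at `x`, `dA = plaquetteCurl A`
(`KernelClosed.cube_coboundary_plaquetteCurl` at `d = 4`). -/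
theorem stub_curlClosed :
    ∀ (A : Literature.MathematicalPhysics.QuantumLattice.ZdEdge 4 → ℝ) (x : Literature.Probability.LatticeModels.Site 4) (i j k : Fin 4) (hij : i < j) (hjk : j < k),
      (Literature.MathematicalPhysics.QuantumFieldTheory.plaquetteCurl A (x + Pi.single i 1, ⟨(j, k), hjk⟩) - Literature.MathematicalPhysics.QuantumFieldTheory.plaquetteCurl A (x, ⟨(j, k), hjk⟩)) -
        (Literature.MathematicalPhysics.QuantumFieldTheory.plaquetteCurl A (x + Pi.single j 1, ⟨(i, k), hij.trans hjk⟩) -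
          Literature.MathematicalPhysics.QuantumFieldTheory.plaquetteCurl A (x, ⟨(i, k), hij.trans hjk⟩)) +
        (Literature.MathematicalPhysics.QuantumFieldTheory.plaquetteCurl A (x + Pi.single k 1, ⟨(i, j), hij⟩) - Literature.MathematicalPhysics.QuantumFieldTheory.plaquetteCurl A (x, ⟨(i, j), hij⟩)) = 0 :=
  fun A x i j k hij hjk => KernelClosed.cube_coboundary_plaquetteCurl A x i j k hij hjk

end Summit.QuantumFields.YangMills.Theorems.EquipartitionPinsProbe

end
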